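import Literature.NumberTheory.DiophantineGeometry.VecWordModel
import Literature.NumberTheory.DiophantineGeometry.WordIsotypicSupport
import HarnessLib

/-!
# Littlewood–Richardson dominance on the word model: `μ ∪ ν ⊴ λ`

Topic file in the Schur–Weyl series (`Literature/NumberTheory/DiophantineGeometry`, trunk
ArithGeomL / CplxAlg), written for the proof of Christandl–Vrana–Zuiddam, *Universal points in the
asymptotic spectrum of tensors*, J. Amer. Math. Soc. 36 (2023), **Lemma 3.11** (sub-additivity of
the upper quantum functional), whose printed proof uses (display before Lemma 3.11, p. 13):

> Let `λ ⊢_{d+e} n+m`, `μ ⊢_d n`, `ν ⊢_e m`. The projections `P_λ^{V ⊕ W}` and `P_μ^V ⊗ P_ν^W`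
> commute, and their product is nonzero iff the Littlewood–Richardson coefficient `c^λ_{μν}` is
> nonzero,

together with the entropy inequality Lemma 3.10.2 for `c^λ_{μν} ≠ 0`. The only property of a
nonzero Littlewood–Richardson coefficient that enters Lemma 3.10.2 (through Schur concavity of the
Shannon entropy, cf. CVZ Remark 3.33) is the classical **dominance** `μ ∪ ν ⊴ λ`: the partition with
parts `μ₁, …, μ_d, ν₁, …, ν_e` is dominated by `λ`. This file proves that dominance directly for the
coordinate word model, with an arbitrary finite-dimensional multiplicity space `E` (the other tensor
legs), in the *support form* of `WordIsotypicSupport.lean`: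

* `sum_append_le_of_charSum_ne_zero` — let the positions `Fin D` be split into a block `P`
  (enumerated by `Fin m`) and its complement (enumerated by `Fin m'`), and the letters `Fin (a + b)`
  into `Fin a ⊔ Fin b`. If `X : Word (a+b) D → E` lies in the image, under the product
  `Z_μ^{[P]} Z_ν^{[Pᶜ]}` of the character sums of `S_m` (permuting the `P`-positions) and `S_{m'}`
  (permuting the other positions), of the space of vectors supported on *block words* (letters `< a`
  exactly at the `P`-positions) — the coordinate form of `im (P_μ^V ⊗ P_ν^W) ⊆ V^{⊗m} ⊗ W^{⊗m'}` —
  and `Z_λ X ≠ 0` for the character sum `Z_λ = ∑_π χ_λ(π) π` of `S_D`, then `μ` has at most `a`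
  parts, `ν` at most `b` parts, and the content `(μ₁,…,μ_a, ν₁,…,ν_b)` on `Fin (a+b)` is dominated by
  `λ`: `∑_{x ∈ S} c_x ≤ λ₁ + ⋯ + λ_{|S|}` for every set `S` of letters.

Proof (highest-weight climbing; Fulton–Harris §6.1/§15.5 for the ingredients): the image `F` is
stable under the block-diagonal subgroup `GL_a × GL_b ⊆ GL_{a+b}` acting on the word model
(`vecWordRep`), `Z_λ` commutes with `GL_{a+b}`, and `Z_μ^{[P]}`, `Z_ν^{[Pᶜ]}` act on `F` as nonzero
scalars. Currying a block-supported vector along the block makes `F` a `GL_a`-stable subspace of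
the `E₁`-valued word model `Word a m → E₁`, `E₁ = (Word b m' → E)`; since such a subspace is spanned
by the `GL_a`-translates of its highest-weight vectors (`le_span_translates_highestWeight_vecWordRep`)
and `ker Z_λ ∩ F` is stable, some highest-weight vector `y ∈ F` has `Z_λ y ≠ 0`; its weight is `μ`
(`Z_μ` acts on `HW_{μ'}` as `δ_{μμ'} m!/f^μ`), so `y` is supported on words whose `P`-part has content
`μ` (`exists_not_mem_of_charSum_eq_smul`). Repeating the argument for `GL_b` inside the subspace of
such vectors yields `z ∈ F`, `Z_λ z ≠ 0`, supported on block words of content `(μ, ν)`; a word in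
the support of `Z_λ z` is a position permutation of such a word, and the support theorem
`card_filter_mem_le_of_mem_range_charSum` (every word in the support of a vector of `im Z_λ` is
dominated by `λ`) concludes.

Contents: the block combinatorics (`glueWord`, `IsBlockWord`, `glueEquiv`), the block-diagonal
embedding `blockDiagGL : GL_a × GL_b → GL_{a+b}` and its action on block-supported vectors
(`vecWordRep_blockDiagGL_apply_glueWord`), the sub-block position actions (`embP`, `embN`, `repP`,
`repN`), the curry maps (`curryA`, `curryB`) with their equivariance, the subspaces `blockSubmodule`,
`blockIsotypic`, and the two theorems above. No named facts. (The tree's proof of CVZ Lemma 3.11,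
`Literature/Computability/AlgebraicComplexity/QuantumFunctionalsDirectSumSubadditive.lean`, runs the
same dominance argument inline for the columns of projected tensor powers; this file isolates the
representation-theoretic statement on the word model, for an arbitrary block of positions and an
arbitrary multiplicity space.)

References: M. Christandl, P. Vrana, J. Zuiddam, J. Amer. Math. Soc. 36 (2023) 31–79 =
arXiv:1709.07851v3, §3.1 (before Lemma 3.11), Lemma 3.10.2, Remark 3.33
[cite: ChristandlVranaZuiddam2023, §3.1]; W. Fulton, J. Harris, *Representation Theory*, GTM 129,
§6.1 Thm. 6.3, §15.5, Ex. 15.23 / (A.8) (Littlewood–Richardson rule) [FultonHarrisGTM129].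
-/

noncomputable section

open scoped BigOperators

namespace Literature.NumberTheory.DiophantineGeometry

variable {k : Type*} [Field k]

/-! ## A weight vector outside a stable subspace -/

section Core

variable {N D : ℕ} {E : Type*} [AddCommGroup E] [Module k E] [FiniteDimensional k E]

/-- **Highest-weight climbing.** Let `K, F` be `GL_N`-stable subspaces of the `E`-valued word model
with `F ⊄ K`, and suppose the character sum `Z_μ = ∑_π χ_μ(π) π` of `S_D` acts on `F` as a nonzero
scalar (e.g. `F ⊆ im Z_μ`). Then some `y ∈ F ∖ K` is supported on words of content `μ`
(and `μ` has at most `N` parts): `F` is spanned by the translates of its highest-weight vectors, one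
of which therefore lies outside `K`; its weight `μ'` satisfies `Z_μ = δ_{μμ'} D!/f^{μ'}` on it, whence
`μ' = μ`. [cite: FultonHarrisGTM129, Thm. 6.3] -/
theorem exists_not_mem_of_charSum_eq_smul [IsAlgClosed k] [CharZero k]
    {F K : Submodule k (Word N D → E)}
    (hF : ∀ g, F ≤ F.comap (vecWordRep k N D E g)) (hK : ∀ g, K ≤ K.comap (vecWordRep k N D E g))
    (hKF : ¬ F ≤ K) (μ : Nat.Partition D) {c : k} (hc : c ≠ 0)
    (hZ : ∀ v ∈ F, (∑ π, spechtCharacter k μ π • vecWordPermRep k N D E π) v = c • v) :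
    ∃ y ∈ F, y ∉ K ∧ μ.parts.card ≤ N ∧
      ∀ (w : Word N D) (i : Fin N), (wordContent w i : ℤ) ≠ Weight.ofPartition N μ i → y w = 0 := by
  obtain ⟨v, χ, hvF, hvχ, hvK⟩ : ∃ (v : Word N D → E) (χ : Weight (Fin N)),
      v ∈ F ∧ v ∈ highestWeightSpace (vecWordRep k N D E) χ ∧ v ∉ K := by
    by_contra h
    push Not at h
    refine hKF ((le_span_translates_highestWeight_vecWordRep F hF).trans (Submodule.span_le.2 ?_))
    rintro _ ⟨g, v, χ, hvF, hvχ, rfl⟩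
    exact hK g (h v χ hvF hvχ)
  have hv0 : v ≠ 0 := fun h => hvK (h ▸ K.zero_mem)
  obtain ⟨μ', hμ'N, rfl⟩ := exists_partition_of_mem_highestWeightSpace_vecWordRep hvχ hv0
  have hZv := charSum_apply_of_mem_highestWeightSpace_vecWordRep μ' hμ'N hvχ μ
  have hμμ' : μ = μ' := by
    by_contra hne
    rw [if_neg hne, zero_smul, hZ v hvF] at hZv
    exact hv0 ((smul_eq_zero.1 hZv).resolve_left hc)
  subst hμμ'
  exact ⟨v, hvF, hvK, hμ'N, fun w i hi =>
    apply_eq_zero_of_mem_highestWeightSpace_vecWordRep hvχ hi⟩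

end Core

/-! ## Block words -/

section Block

variable {a b D m m' : ℕ}
variable (P : Fin D → Prop) [DecidablePred P] (eP : Fin m ≃ {p // P p}) (eN : Fin m' ≃ {p // ¬ P p})

/-- **Gluing** a word `u` of length `m` on the letters `Fin a` and a word `v` of length `m'` on the
letters `Fin b` into a word of length `D` on `Fin (a + b)`: the `P`-positions (enumerated by `eP`)
carry the letters of `u` (embedded by `Fin.castAdd`), the other positions (enumerated by `eN`) the
letters of `v` (embedded by `Fin.natAdd`). This is the basis bijection behind
`V^{⊗m} ⊗ W^{⊗m'} ↪ (V ⊕ W)^{⊗(m+m')}` (CVZ, proof of Lemma 3.11: the summand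
`s^{⊗m} ⊗ t^{⊗(n-m)}` of `(s ⊕ t)^{⊗n}`). [cite: ChristandlVranaZuiddam2023, Lemma 3.11 (proof)] -/
def glueWord (u : Word a m) (v : Word b m') : Word (a + b) D := fun p =>
  if h : P p then Fin.castAdd b (u (eP.symm ⟨p, h⟩)) else Fin.natAdd a (v (eN.symm ⟨p, h⟩))

/-- **Block words**: the letters `< a` sit exactly at the `P`-positions. [folklore] -/
def IsBlockWord (W : Word (a + b) D) : Prop := ∀ p, (W p : ℕ) < a ↔ P p

/-- The glued word at a `P`-position (dependent form). [folklore] -/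
theorem glueWord_apply_of_pos (u : Word a m) (v : Word b m') {p : Fin D} (h : P p) :
    glueWord P eP eN u v p = Fin.castAdd b (u (eP.symm ⟨p, h⟩)) := by
  simp [glueWord, h]

/-- The glued word off the `P`-positions (dependent form). [folklore] -/
theorem glueWord_apply_of_neg (u : Word a m) (v : Word b m') {p : Fin D} (h : ¬ P p) :
    glueWord P eP eN u v p = Fin.natAdd a (v (eN.symm ⟨p, h⟩)) := by
  simp [glueWord, h]

/-- The glued word at a `P`-position. [folklore] -/
@[simp] theorem glueWord_apply_eP (u : Word a m) (v : Word b m') (i : Fin m) :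
    glueWord P eP eN u v (eP i) = Fin.castAdd b (u i) := by
  rw [glueWord_apply_of_pos P eP eN u v (eP i).2, Subtype.coe_eta, Equiv.symm_apply_apply]

/-- The glued word off the `P`-positions. [folklore] -/
@[simp] theorem glueWord_apply_eN (u : Word a m) (v : Word b m') (j : Fin m') :
    glueWord P eP eN u v (eN j) = Fin.natAdd a (v j) := by
  rw [glueWord_apply_of_neg P eP eN u v (eN j).2, Subtype.coe_eta, Equiv.symm_apply_apply]

omit [DecidablePred P] in
/-- An embedded second-block letter is never an embedded first-block letter. [folklore] -/
theorem natAdd_ne_castAdd (j : Fin b) (i : Fin a) : Fin.natAdd a j ≠ Fin.castAdd b i := by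
  intro h
  have := congrArg Fin.val h
  simp only [Fin.val_natAdd, Fin.val_castAdd] at this
  omega

/-- Glued words are block words. [folklore] -/
theorem isBlockWord_glueWord (u : Word a m) (v : Word b m') : IsBlockWord P (glueWord P eP eN u v) := by
  intro p
  by_cases h : P p
  · rw [glueWord_apply_of_pos P eP eN u v h]
    simp [h]
  · rw [glueWord_apply_of_neg P eP eN u v h]
    simp [h]

/-- The first part of a block word (its letters at the `P`-positions). [folklore] -/
def fstPart (W : Word (a + b) D) (hW : IsBlockWord P W) : Word a m :=
  fun i => ⟨W (eP i), (hW _).2 (eP i).2⟩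

/-- The second part of a block word (its letters off the `P`-positions, shifted by `a`).
[folklore] -/
def sndPart (W : Word (a + b) D) (hW : IsBlockWord P W) : Word b m' :=
  fun j => ⟨W (eN j) - a, by
    have h1 : ¬ ((W (eN j) : ℕ) < a) := fun h' => (eN j).2 ((hW _).1 h')
    have h2 := (W (eN j)).isLt
    omega⟩

/-- A block word is the gluing of its two parts. [folklore] -/
theorem glueWord_fstPart_sndPart (W : Word (a + b) D) (hW : IsBlockWord P W) :
    glueWord P eP eN (fstPart P eP W hW) (sndPart P eN W hW) = W := by
  funext p
  by_cases h : P p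
  · rw [glueWord_apply_of_pos P eP eN _ _ h]
    apply Fin.ext
    simp [fstPart]
  · rw [glueWord_apply_of_neg P eP eN _ _ h]
    apply Fin.ext
    have h1 : ¬ ((W p : ℕ) < a) := fun h' => h ((hW p).1 h')
    simp only [sndPart, Fin.val_natAdd, Equiv.apply_symm_apply]
    omega

/-- The first part of a glued word. [folklore] -/
theorem fstPart_glueWord (u : Word a m) (v : Word b m') :
    fstPart P eP (glueWord P eP eN u v) (isBlockWord_glueWord P eP eN u v) = u := by
  funext i
  apply Fin.ext
  change ((glueWord P eP eN u v (eP i) : Fin (a + b)) : ℕ) = _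
  rw [glueWord_apply_eP, Fin.val_castAdd]

/-- The second part of a glued word. [folklore] -/
theorem sndPart_glueWord (u : Word a m) (v : Word b m') :
    sndPart P eN (glueWord P eP eN u v) (isBlockWord_glueWord P eP eN u v) = v := by
  funext j
  apply Fin.ext
  change ((glueWord P eP eN u v (eN j) : Fin (a + b)) : ℕ) - a = _
  rw [glueWord_apply_eN, Fin.val_natAdd]
  omega

/-- **Block words ↔ pairs of words**: gluing is a bijection from `Word a m × Word b m'` onto the block
words. [folklore] -/
def glueEquiv : Word a m × Word b m' ≃ {W : Word (a + b) D // IsBlockWord P W} where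
  toFun uv := ⟨glueWord P eP eN uv.1 uv.2, isBlockWord_glueWord P eP eN _ _⟩
  invFun W := (fstPart P eP W.1 W.2, sndPart P eN W.1 W.2)
  left_inv uv := by
    ext : 1
    · exact fstPart_glueWord P eP eN uv.1 uv.2
    · exact sndPart_glueWord P eP eN uv.1 uv.2
  right_inv W := Subtype.ext (glueWord_fstPart_sndPart P eP eN W.1 W.2)

/-- A sum over all words of a function vanishing off the block words is a double sum over glued
words. [folklore] -/
theorem sum_eq_sum_glueWord {M : Type*} [AddCommMonoid M] (f : Word (a + b) D → M)
    (hf : ∀ W, ¬ IsBlockWord P W → f W = 0) :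
    ∑ W, f W = ∑ u : Word a m, ∑ v : Word b m', f (glueWord P eP eN u v) := by
  classical
  rw [← Fintype.sum_subtype_add_sum_subtype (IsBlockWord P) f]
  have h0 : ∑ W : {W // ¬ IsBlockWord P W}, f W = 0 := Finset.sum_eq_zero fun W _ => hf W.1 W.2
  rw [h0, add_zero, ← Fintype.sum_prod_type']
  exact (Fintype.sum_equiv (glueEquiv P eP eN) (fun uv => f (glueWord P eP eN uv.1 uv.2))
    (fun W => f W) fun uv => rfl).symm

/-- Contents of a glued word: first-block letters. [folklore] -/
theorem wordContent_glueWord_castAdd (u : Word a m) (v : Word b m') (i : Fin a) :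
    wordContent (glueWord P eP eN u v) (Fin.castAdd b i) = wordContent u i := by
  classical
  simp only [wordContent, Finset.card_filter]
  rw [← Fintype.sum_subtype_add_sum_subtype P]
  have h1 : (∑ p : {p // P p}, if glueWord P eP eN u v p = Fin.castAdd b i then 1 else 0) =
      ∑ q : Fin m, if u q = i then 1 else 0 := by
    refine (Fintype.sum_equiv eP _ _ fun q => ?_).symm
    simp only [glueWord_apply_eP]
    by_cases hq : u q = i
    · rw [if_pos hq, if_pos (by rw [hq])]
    · rw [if_neg hq, if_neg]
      intro h
      apply hq
      apply Fin.ext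
      have := congrArg Fin.val h
      simpa using this
  have h2 : (∑ p : {p // ¬ P p}, if glueWord P eP eN u v p = Fin.castAdd b i then 1 else 0) = 0 := by
    refine Finset.sum_eq_zero fun p _ => ?_
    rw [if_neg]
    rw [glueWord_apply_of_neg P eP eN u v p.2]
    exact natAdd_ne_castAdd _ _
  rw [h1, h2, add_zero]

/-- Contents of a glued word: second-block letters. [folklore] -/
theorem wordContent_glueWord_natAdd (u : Word a m) (v : Word b m') (j : Fin b) :
    wordContent (glueWord P eP eN u v) (Fin.natAdd a j) = wordContent v j := by
  classical
  simp only [wordContent, Finset.card_filter]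
  rw [← Fintype.sum_subtype_add_sum_subtype P]
  have h1 : (∑ p : {p // P p}, if glueWord P eP eN u v p = Fin.natAdd a j then 1 else 0) = 0 := by
    refine Finset.sum_eq_zero fun p _ => ?_
    rw [if_neg]
    rw [glueWord_apply_of_pos P eP eN u v p.2]
    exact (natAdd_ne_castAdd _ _).symm
  have h2 : (∑ p : {p // ¬ P p}, if glueWord P eP eN u v p = Fin.natAdd a j then 1 else 0) =
      ∑ q : Fin m', if v q = j then 1 else 0 := by
    refine (Fintype.sum_equiv eN _ _ fun q => ?_).symm
    simp only [glueWord_apply_eN]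
    by_cases hq : v q = j
    · rw [if_pos hq, if_pos (by rw [hq])]
    · rw [if_neg hq, if_neg]
      intro h
      apply hq
      apply Fin.ext
      have := congrArg Fin.val h
      simpa using this
  rw [h1, h2, zero_add]

omit [DecidablePred P] in
/-- `#{p | W p ∈ S} = ∑_{x ∈ S} content_x(W)`. [folklore] -/
theorem card_filter_mem_eq_sum_wordContent {N n : ℕ} (W : Word N n) (S : Finset (Fin N)) :
    (Finset.univ.filter fun p : Fin n => W p ∈ S).card = ∑ x ∈ S, wordContent W x := by
  classical
  rw [Finset.card_eq_sum_card_fiberwise (f := W) (s := Finset.univ.filter fun p : Fin n => W p ∈ S)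
    (t := S) fun p hp => by simpa using hp]
  refine Finset.sum_congr rfl fun x hx => ?_
  rw [wordContent]
  congr 1
  ext p
  simp only [Finset.mem_filter, Finset.mem_univ, true_and]
  exact ⟨fun h => h.2, fun h => ⟨by rw [h]; exact hx, h⟩⟩

/-! ## The block-diagonal subgroup `GL_a × GL_b ⊆ GL_{a+b}` -/

omit [DecidablePred P] in
/-- The block-diagonal matrix `diag(g, h)` on `Fin (a + b)` (letters `< a` first).
[cite: ChristandlVranaZuiddam2023, Def. 3.8 (block diagonal embedding)] -/
def blockDiag (g : Matrix (Fin a) (Fin a) k) (h : Matrix (Fin b) (Fin b) k) :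
    Matrix (Fin (a + b)) (Fin (a + b)) k :=
  Matrix.reindex finSumFinEquiv finSumFinEquiv (Matrix.fromBlocks g 0 0 h)

/-- Entries of `diag(g, h)` through `Fin (a + b) ≃ Fin a ⊕ Fin b`. [folklore] -/
theorem blockDiag_apply (g : Matrix (Fin a) (Fin a) k) (h : Matrix (Fin b) (Fin b) k)
    (x y : Fin (a + b)) :
    blockDiag g h x y = Matrix.fromBlocks g 0 0 h (finSumFinEquiv.symm x) (finSumFinEquiv.symm y) :=
  rfl

/-- Upper-left block of `diag(g, h)`. [folklore] -/
@[simp] theorem blockDiag_castAdd_castAdd (g : Matrix (Fin a) (Fin a) k) (h : Matrix (Fin b) (Fin b) k)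
    (i j : Fin a) : blockDiag g h (Fin.castAdd b i) (Fin.castAdd b j) = g i j := by
  rw [blockDiag_apply, finSumFinEquiv_symm_apply_castAdd, finSumFinEquiv_symm_apply_castAdd,
    Matrix.fromBlocks_apply₁₁]

/-- Lower-right block of `diag(g, h)`. [folklore] -/
@[simp] theorem blockDiag_natAdd_natAdd (g : Matrix (Fin a) (Fin a) k) (h : Matrix (Fin b) (Fin b) k)
    (i j : Fin b) : blockDiag g h (Fin.natAdd a i) (Fin.natAdd a j) = h i j := by
  rw [blockDiag_apply, finSumFinEquiv_symm_apply_natAdd, finSumFinEquiv_symm_apply_natAdd,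
    Matrix.fromBlocks_apply₂₂]

/-- Upper-right block of `diag(g, h)` vanishes. [folklore] -/
@[simp] theorem blockDiag_castAdd_natAdd (g : Matrix (Fin a) (Fin a) k) (h : Matrix (Fin b) (Fin b) k)
    (i : Fin a) (j : Fin b) : blockDiag g h (Fin.castAdd b i) (Fin.natAdd a j) = 0 := by
  rw [blockDiag_apply, finSumFinEquiv_symm_apply_castAdd, finSumFinEquiv_symm_apply_natAdd,
    Matrix.fromBlocks_apply₁₂, Matrix.zero_apply]

/-- Lower-left block of `diag(g, h)` vanishes. [folklore] -/
@[simp] theorem blockDiag_natAdd_castAdd (g : Matrix (Fin a) (Fin a) k) (h : Matrix (Fin b) (Fin b) k)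
    (j : Fin b) (i : Fin a) : blockDiag g h (Fin.natAdd a j) (Fin.castAdd b i) = 0 := by
  rw [blockDiag_apply, finSumFinEquiv_symm_apply_natAdd, finSumFinEquiv_symm_apply_castAdd,
    Matrix.fromBlocks_apply₂₁, Matrix.zero_apply]

/-- Off-diagonal-block entries of `diag(g, h)` vanish. [folklore] -/
theorem blockDiag_apply_eq_zero (g : Matrix (Fin a) (Fin a) k) (h : Matrix (Fin b) (Fin b) k)
    {x y : Fin (a + b)} (hxy : ¬ ((x : ℕ) < a ↔ (y : ℕ) < a)) : blockDiag g h x y = 0 := by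
  induction x using Fin.addCases with
  | left i =>
    induction y using Fin.addCases with
    | left j => exact absurd ⟨fun _ => by simp, fun _ => by simp⟩ hxy
    | right j => exact blockDiag_castAdd_natAdd g h i j
  | right i =>
    induction y using Fin.addCases with
    | left j => exact blockDiag_natAdd_castAdd g h i j
    | right j => exact absurd ⟨fun h' => by simp at h', fun h' => by simp at h'⟩ hxy

/-- `diag` is multiplicative. [folklore] -/
theorem blockDiag_mul (g g' : Matrix (Fin a) (Fin a) k) (h h' : Matrix (Fin b) (Fin b) k) :
    blockDiag (g * g') (h * h') = blockDiag g h * blockDiag g' h' := by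
  simp only [blockDiag, Matrix.reindex_apply]
  rw [Matrix.submatrix_mul_equiv, Matrix.fromBlocks_multiply]
  simp

/-- `diag(1, 1) = 1`. [folklore] -/
theorem blockDiag_one : blockDiag (1 : Matrix (Fin a) (Fin a) k) (1 : Matrix (Fin b) (Fin b) k) = 1 := by
  simp only [blockDiag, Matrix.reindex_apply]
  rw [Matrix.fromBlocks_one, Matrix.submatrix_one_equiv]

/-- **The block-diagonal embedding `GL_a × GL_b → GL_{a+b}`**, `(g, h) ↦ diag(g, h)` (CVZ Def. 3.8:
restriction "via the block diagonal embedding `GL_a × GL_b → GL_{a+b}`").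
[cite: ChristandlVranaZuiddam2023, Def. 3.8] -/
def blockDiagGL (g : GL (Fin a) k) (h : GL (Fin b) k) : GL (Fin (a + b)) k :=
  ⟨blockDiag (g : Matrix (Fin a) (Fin a) k) (h : Matrix (Fin b) (Fin b) k),
    blockDiag ((g⁻¹ : GL (Fin a) k) : Matrix (Fin a) (Fin a) k) ((h⁻¹ : GL (Fin b) k) : Matrix _ _ k),
    by rw [← blockDiag_mul, Units.mul_inv, Units.mul_inv, blockDiag_one],
    by rw [← blockDiag_mul, Units.inv_mul, Units.inv_mul, blockDiag_one]⟩

/-- The matrix of `blockDiagGL g h`. [folklore] -/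
@[simp] theorem coe_blockDiagGL (g : GL (Fin a) k) (h : GL (Fin b) k) :
    ((blockDiagGL g h : GL (Fin (a + b)) k) : Matrix (Fin (a + b)) (Fin (a + b)) k) =
      blockDiag (g : Matrix (Fin a) (Fin a) k) (h : Matrix (Fin b) (Fin b) k) := rfl

/-! ## The block-diagonal subgroup on block-supported vectors -/

variable {E : Type*} [AddCommGroup E] [Module k E]

omit [DecidablePred P] in
/-- `diag(g, h)` preserves the space of vectors supported on block words. [folklore] -/
theorem vecWordRep_blockDiagGL_apply_eq_zero {X : Word (a + b) D → E}
    (hX : ∀ W, ¬ IsBlockWord P W → X W = 0) (g : GL (Fin a) k) (h : GL (Fin b) k)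
    (W' : Word (a + b) D) (hW' : ¬ IsBlockWord P W') :
    vecWordRep k (a + b) D E (blockDiagGL g h) X W' = 0 := by
  rw [vecWordRep_apply]
  refine Finset.sum_eq_zero fun W _ => ?_
  by_cases hW : IsBlockWord P W
  · obtain ⟨p, hp⟩ : ∃ p, ¬ (((W' p : ℕ) < a) ↔ P p) := not_forall.1 hW'
    rw [Finset.prod_eq_zero (Finset.mem_univ p), zero_smul]
    rw [coe_blockDiagGL]
    exact blockDiag_apply_eq_zero _ _ (by rwa [hW p])
  · rw [hX W hW, smul_zero]

/-- **The action of `diag(g, h)` on a block-supported vector**, evaluated at a glued word: the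
Kronecker product of the word actions of `g` on the first parts and of `h` on the second parts,
`(diag(g,h) · X)(u' ⋆ v') = ∑_{u, v} (∏ᵢ g_{u'ᵢ uᵢ}) (∏ⱼ h_{v'ⱼ vⱼ}) X(u ⋆ v)`.
[cite: ChristandlVranaZuiddam2023, Lemma 3.10 (proof)] -/
theorem vecWordRep_blockDiagGL_apply_glueWord {X : Word (a + b) D → E}
    (hX : ∀ W, ¬ IsBlockWord P W → X W = 0) (g : GL (Fin a) k) (h : GL (Fin b) k)
    (u' : Word a m) (v' : Word b m') :
    vecWordRep k (a + b) D E (blockDiagGL g h) X (glueWord P eP eN u' v') =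
      ∑ u : Word a m, ∑ v : Word b m',
        ((∏ i, (g : Matrix (Fin a) (Fin a) k) (u' i) (u i)) *
          ∏ j, (h : Matrix (Fin b) (Fin b) k) (v' j) (v j)) • X (glueWord P eP eN u v) := by
  rw [vecWordRep_apply, sum_eq_sum_glueWord P eP eN _ (fun W hW => by rw [hX W hW, smul_zero])]
  refine Finset.sum_congr rfl fun u _ => Finset.sum_congr rfl fun v _ => ?_
  congr 1
  rw [coe_blockDiagGL, ← Fintype.prod_subtype_mul_prod_subtype P]
  congr 1
  · refine (Fintype.prod_equiv eP _ _ fun i => ?_).symm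
    rw [glueWord_apply_eP, glueWord_apply_eP, blockDiag_castAdd_castAdd]
  · refine (Fintype.prod_equiv eN _ _ fun j => ?_).symm
    rw [glueWord_apply_eN, glueWord_apply_eN, blockDiag_natAdd_natAdd]

/-! ## Permuting the positions inside the blocks -/

/-- `S_m` permuting the `P`-positions (through the enumeration `eP`), as a subgroup of `S_D`.
[cite: ChristandlVranaZuiddam2023, Lemma 3.11 (proof)] -/
def embP : Equiv.Perm (Fin m) →* Equiv.Perm (Fin D) :=
  (Equiv.Perm.ofSubtype : Equiv.Perm {p // P p} →* Equiv.Perm (Fin D)).comp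
    (eP.permCongrHom : Equiv.Perm (Fin m) ≃* Equiv.Perm {p // P p}).toMonoidHom

/-- `S_{m'}` permuting the positions off `P` (through the enumeration `eN`), as a subgroup of `S_D`.
[cite: ChristandlVranaZuiddam2023, Lemma 3.11 (proof)] -/
def embN : Equiv.Perm (Fin m') →* Equiv.Perm (Fin D) :=
  (Equiv.Perm.ofSubtype : Equiv.Perm {p // ¬ P p} →* Equiv.Perm (Fin D)).comp
    (eN.permCongrHom : Equiv.Perm (Fin m') ≃* Equiv.Perm {p // ¬ P p}).toMonoidHom

/-- Unfolding of `embP`. [folklore] -/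
theorem embP_eq (σ : Equiv.Perm (Fin m)) : embP P eP σ = Equiv.Perm.ofSubtype (eP.permCongr σ) := rfl

/-- Unfolding of `embN`. [folklore] -/
theorem embN_eq (τ : Equiv.Perm (Fin m')) : embN P eN τ = Equiv.Perm.ofSubtype (eN.permCongr τ) := rfl

/-- `embP σ` on a `P`-position. [folklore] -/
theorem embP_apply_of_pos (σ : Equiv.Perm (Fin m)) {p : Fin D} (hp : P p) :
    embP P eP σ p = eP (σ (eP.symm ⟨p, hp⟩)) := by
  rw [embP_eq, Equiv.Perm.ofSubtype_apply_of_mem (p := P) _ hp, Equiv.permCongr_apply]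

/-- `embP σ` fixes the positions off `P`. [folklore] -/
theorem embP_apply_of_neg (σ : Equiv.Perm (Fin m)) {p : Fin D} (hp : ¬ P p) : embP P eP σ p = p := by
  rw [embP_eq, Equiv.Perm.ofSubtype_apply_of_not_mem (p := P) _ hp]

/-- `embN τ` on a position off `P`. [folklore] -/
theorem embN_apply_of_neg (τ : Equiv.Perm (Fin m')) {p : Fin D} (hp : ¬ P p) :
    embN P eN τ p = eN (τ (eN.symm ⟨p, hp⟩)) := by
  rw [embN_eq, Equiv.Perm.ofSubtype_apply_of_mem (p := fun q => ¬ P q) _ hp, Equiv.permCongr_apply]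

/-- `embN τ` fixes the `P`-positions. [folklore] -/
theorem embN_apply_of_pos (τ : Equiv.Perm (Fin m')) {p : Fin D} (hp : P p) : embN P eN τ p = p := by
  rw [embN_eq, Equiv.Perm.ofSubtype_apply_of_not_mem (p := fun q => ¬ P q) _ (not_not.2 hp)]

/-- `embP σ` preserves the block of positions. [folklore] -/
theorem pos_embP_iff (σ : Equiv.Perm (Fin m)) (p : Fin D) : P (embP P eP σ p) ↔ P p := by
  by_cases hp : P p
  · rw [embP_apply_of_pos P eP σ hp]
    exact ⟨fun _ => hp, fun _ => (eP _).2⟩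
  · rw [embP_apply_of_neg P eP σ hp]

/-- `embN τ` preserves the block of positions. [folklore] -/
theorem pos_embN_iff (τ : Equiv.Perm (Fin m')) (p : Fin D) : P (embN P eN τ p) ↔ P p := by
  by_cases hp : P p
  · rw [embN_apply_of_pos P eN τ hp]
  · rw [embN_apply_of_neg P eN τ hp]
    exact ⟨fun h => absurd h (eN _).2, fun h => absurd h hp⟩

/-- The two sub-block actions commute. [folklore] -/
theorem embP_mul_embN_comm (σ : Equiv.Perm (Fin m)) (τ : Equiv.Perm (Fin m')) :
    embP P eP σ * embN P eN τ = embN P eN τ * embP P eP σ := by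
  ext p : 1
  rw [Equiv.Perm.mul_apply, Equiv.Perm.mul_apply]
  by_cases hp : P p
  · rw [embN_apply_of_pos P eN τ hp, embN_apply_of_pos P eN τ ((pos_embP_iff P eP σ p).2 hp)]
  · rw [embP_apply_of_neg P eP σ hp, embP_apply_of_neg P eP σ]
    rwa [pos_embN_iff P eN τ p]

/-- Permuting the `P`-positions of a glued word permutes the first part. [folklore] -/
theorem glueWord_comp_embP (u : Word a m) (v : Word b m') (σ : Equiv.Perm (Fin m)) :
    glueWord P eP eN u v ∘ (embP P eP σ) = glueWord P eP eN (u ∘ σ) v := by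
  funext p
  simp only [Function.comp_apply]
  by_cases hp : P p
  · rw [embP_apply_of_pos P eP σ hp, glueWord_apply_eP, glueWord_apply_of_pos P eP eN _ _ hp]
    rfl
  · rw [embP_apply_of_neg P eP σ hp, glueWord_apply_of_neg P eP eN _ _ hp,
      glueWord_apply_of_neg P eP eN _ _ hp]

/-- Permuting the other positions of a glued word permutes the second part. [folklore] -/
theorem glueWord_comp_embN (u : Word a m) (v : Word b m') (τ : Equiv.Perm (Fin m')) :
    glueWord P eP eN u v ∘ (embN P eN τ) = glueWord P eP eN u (v ∘ τ) := by
  funext p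
  simp only [Function.comp_apply]
  by_cases hp : P p
  · rw [embN_apply_of_pos P eN τ hp, glueWord_apply_of_pos P eP eN _ _ hp,
      glueWord_apply_of_pos P eP eN _ _ hp]
  · rw [embN_apply_of_neg P eN τ hp, glueWord_apply_eN, glueWord_apply_of_neg P eP eN _ _ hp]
    rfl

omit [DecidablePred P] in
/-- Block words are preserved by position permutations respecting `P`. [folklore] -/
theorem isBlockWord_comp_iff (W : Word (a + b) D) {π : Equiv.Perm (Fin D)}
    (hπ : ∀ p, P (π p) ↔ P p) : IsBlockWord P (W ∘ π) ↔ IsBlockWord P W := by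
  constructor
  · intro h q
    have := h (π.symm q)
    simp only [Function.comp_apply, Equiv.apply_symm_apply] at this
    rw [this, ← hπ (π.symm q), Equiv.apply_symm_apply]
  · intro h p
    have := h (π p)
    rw [hπ p] at this
    exact this

variable (k E)

/-- The representation of `S_m` on the `E`-valued word model permuting the `P`-positions.
[cite: ChristandlVranaZuiddam2023, Lemma 3.11 (proof)] -/
def repP : Representation k (Equiv.Perm (Fin m)) (Word (a + b) D → E) :=
  (vecWordPermRep k (a + b) D E).comp (embP P eP)

/-- The representation of `S_{m'}` on the `E`-valued word model permuting the positions off `P`.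
[cite: ChristandlVranaZuiddam2023, Lemma 3.11 (proof)] -/
def repN : Representation k (Equiv.Perm (Fin m')) (Word (a + b) D → E) :=
  (vecWordPermRep k (a + b) D E).comp (embN P eN)

variable {k E}

/-- Unfolding of `repP`. [folklore] -/
@[simp] theorem repP_apply (σ : Equiv.Perm (Fin m)) (X : Word (a + b) D → E) (W : Word (a + b) D) :
    repP k P eP E σ X W = X (W ∘ embP P eP σ) := rfl

/-- Unfolding of `repN`. [folklore] -/
@[simp] theorem repN_apply (τ : Equiv.Perm (Fin m')) (X : Word (a + b) D → E) (W : Word (a + b) D) :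
    repN k P eN E τ X W = X (W ∘ embN P eN τ) := rfl

/-- The two sub-block representations commute. [folklore] -/
theorem repP_repN_comm (σ : Equiv.Perm (Fin m)) (τ : Equiv.Perm (Fin m')) (X : Word (a + b) D → E) :
    repP k P eP E σ (repN k P eN E τ X) = repN k P eN E τ (repP k P eP E σ X) := by
  funext W
  simp only [repP_apply, repN_apply]
  rw [Function.comp_assoc, Function.comp_assoc, ← Equiv.Perm.coe_mul, ← Equiv.Perm.coe_mul,
    embP_mul_embN_comm]

/-- The character sums `Z_μ^{[P]}` and `Z_ν^{[Pᶜ]}` commute. [folklore] -/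
theorem charSumP_charSumN_comm (μ : Nat.Partition m) (ν : Nat.Partition m')
    (X : Word (a + b) D → E) :
    (∑ σ, spechtCharacter k μ σ • repP k P eP E σ) ((∑ τ, spechtCharacter k ν τ • repN k P eN E τ) X) =
      (∑ τ, spechtCharacter k ν τ • repN k P eN E τ) ((∑ σ, spechtCharacter k μ σ • repP k P eP E σ) X) := by
  simp only [LinearMap.sum_apply, LinearMap.smul_apply, map_sum, map_smul, repP_repN_comm,
    Finset.smul_sum]
  rw [Finset.sum_comm]
  exact Finset.sum_congr rfl fun σ _ => Finset.sum_congr rfl fun τ _ => smul_comm _ _ _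

/-- The sub-block actions commute with the `GL_{a+b}`-action. [folklore] -/
theorem repP_vecWordRep (σ : Equiv.Perm (Fin m)) (g : GL (Fin (a + b)) k) (X : Word (a + b) D → E) :
    repP k P eP E σ (vecWordRep k (a + b) D E g X) = vecWordRep k (a + b) D E g (repP k P eP E σ X) :=
  vecWordPermRep_vecWordRep _ g X

/-- The second sub-block action commutes with the `GL_{a+b}`-action. [folklore] -/
theorem repN_vecWordRep (τ : Equiv.Perm (Fin m')) (g : GL (Fin (a + b)) k) (X : Word (a + b) D → E) :
    repN k P eN E τ (vecWordRep k (a + b) D E g X) = vecWordRep k (a + b) D E g (repN k P eN E τ X) :=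
  vecWordPermRep_vecWordRep _ g X

/-- A character sum of a representation commuting with a linear map commutes with it. [folklore] -/
theorem charSum_apply_comm {G : Type*} [Group G] [Fintype G] {V : Type*} [AddCommGroup V] [Module k V]
    (χ : G → k) (ρ : Representation k G V) (T : V →ₗ[k] V) (hT : ∀ g v, ρ g (T v) = T (ρ g v)) (v : V) :
    (∑ g, χ g • ρ g) (T v) = T ((∑ g, χ g • ρ g) v) := by
  rw [LinearMap.sum_apply, LinearMap.sum_apply, map_sum]
  refine Finset.sum_congr rfl fun g _ => ?_
  rw [LinearMap.smul_apply, LinearMap.smul_apply, map_smul, hT]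

/-! ## Currying along the block -/

variable (k)

/-- **Currying a vector along the block**, first part outermost: `(curryA X)(u)(v) = X(u ⋆ v)`, the
coordinate form of `V^{⊗m} ⊗ W^{⊗m'} ⊗ E ≅ V^{⊗m} ⊗ E₁`, `E₁ = W^{⊗m'} ⊗ E`.
[cite: ChristandlVranaZuiddam2023, Lemma 3.10 (proof)] -/
def curryA : (Word (a + b) D → E) →ₗ[k] (Word a m → Word b m' → E) where
  toFun X u v := X (glueWord P eP eN u v)
  map_add' _ _ := rfl
  map_smul' _ _ := rfl

/-- **Currying a vector along the block**, second part outermost: `(curryB X)(v)(u) = X(u ⋆ v)`.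
[cite: ChristandlVranaZuiddam2023, Lemma 3.10 (proof)] -/
def curryB : (Word (a + b) D → E) →ₗ[k] (Word b m' → Word a m → E) where
  toFun X v u := X (glueWord P eP eN u v)
  map_add' _ _ := rfl
  map_smul' _ _ := rfl

variable {k}

/-- Unfolding of `curryA`. [folklore] -/
@[simp] theorem curryA_apply (X : Word (a + b) D → E) (u : Word a m) (v : Word b m') :
    curryA k P eP eN X u v = X (glueWord P eP eN u v) := rfl

/-- Unfolding of `curryB`. [folklore] -/
@[simp] theorem curryB_apply (X : Word (a + b) D → E) (v : Word b m') (u : Word a m) :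
    curryB k P eP eN X v u = X (glueWord P eP eN u v) := rfl

/-- A block-supported vector with vanishing curry vanishes. [folklore] -/
theorem eq_zero_of_curryA_eq_zero {X : Word (a + b) D → E} (hX : ∀ W, ¬ IsBlockWord P W → X W = 0)
    (h0 : curryA k P eP eN X = 0) : X = 0 := by
  funext W
  by_cases hW : IsBlockWord P W
  · have := congrFun (congrFun h0 (fstPart P eP W hW)) (sndPart P eN W hW)
    rw [curryA_apply, glueWord_fstPart_sndPart] at this
    exact this
  · exact hX W hW

/-- A block-supported vector with vanishing `curryB` vanishes. [folklore] -/
theorem eq_zero_of_curryB_eq_zero {X : Word (a + b) D → E} (hX : ∀ W, ¬ IsBlockWord P W → X W = 0)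
    (h0 : curryB k P eP eN X = 0) : X = 0 := by
  funext W
  by_cases hW : IsBlockWord P W
  · have := congrFun (congrFun h0 (sndPart P eN W hW)) (fstPart P eP W hW)
    rw [curryB_apply, glueWord_fstPart_sndPart] at this
    exact this
  · exact hX W hW

/-- `curryA` intertwines `S_m` on the `P`-positions with `S_m` on the outer word. [folklore] -/
theorem curryA_repP (σ : Equiv.Perm (Fin m)) (X : Word (a + b) D → E) :
    curryA k P eP eN (repP k P eP E σ X) = vecWordPermRep k a m (Word b m' → E) σ (curryA k P eP eN X) := by
  funext u v
  simp only [curryA_apply, repP_apply, vecWordPermRep_apply]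
  rw [glueWord_comp_embP]

/-- `curryB` intertwines `S_{m'}` off `P` with `S_{m'}` on the outer word. [folklore] -/
theorem curryB_repN (τ : Equiv.Perm (Fin m')) (X : Word (a + b) D → E) :
    curryB k P eP eN (repN k P eN E τ X) = vecWordPermRep k b m' (Word a m → E) τ (curryB k P eP eN X) := by
  funext v u
  simp only [curryB_apply, repN_apply, vecWordPermRep_apply]
  rw [glueWord_comp_embN]

/-- `curryA` carries `Z_μ^{[P]}` to the character sum `Z_μ` of the outer word model. [folklore] -/
theorem curryA_charSumP (μ : Nat.Partition m) (X : Word (a + b) D → E) :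
    curryA k P eP eN ((∑ σ, spechtCharacter k μ σ • repP k P eP E σ) X) =
      (∑ σ, spechtCharacter k μ σ • vecWordPermRep k a m (Word b m' → E) σ) (curryA k P eP eN X) := by
  rw [LinearMap.sum_apply, LinearMap.sum_apply, map_sum]
  refine Finset.sum_congr rfl fun σ _ => ?_
  rw [LinearMap.smul_apply, LinearMap.smul_apply, map_smul, curryA_repP]

/-- `curryB` carries `Z_ν^{[Pᶜ]}` to the character sum `Z_ν` of the outer word model. [folklore] -/
theorem curryB_charSumN (ν : Nat.Partition m') (X : Word (a + b) D → E) :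
    curryB k P eP eN ((∑ τ, spechtCharacter k ν τ • repN k P eN E τ) X) =
      (∑ τ, spechtCharacter k ν τ • vecWordPermRep k b m' (Word a m → E) τ) (curryB k P eP eN X) := by
  rw [LinearMap.sum_apply, LinearMap.sum_apply, map_sum]
  refine Finset.sum_congr rfl fun τ _ => ?_
  rw [LinearMap.smul_apply, LinearMap.smul_apply, map_smul, curryB_repN]

/-- The action of `diag(g, 1)` at a glued word: only the first parts move. [folklore] -/
theorem vecWordRep_blockDiagGL_one_apply_glueWord {X : Word (a + b) D → E}
    (hX : ∀ W, ¬ IsBlockWord P W → X W = 0) (g : GL (Fin a) k) (u' : Word a m) (v : Word b m') :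
    vecWordRep k (a + b) D E (blockDiagGL g 1) X (glueWord P eP eN u' v) =
      ∑ u : Word a m, (∏ i, (g : Matrix (Fin a) (Fin a) k) (u' i) (u i)) • X (glueWord P eP eN u v) := by
  rw [vecWordRep_blockDiagGL_apply_glueWord P eP eN hX]
  refine Finset.sum_congr rfl fun u _ => ?_
  rw [Finset.sum_eq_single v]
  · congr 1
    simp
  · intro v'' _ hv
    obtain ⟨j, hj⟩ : ∃ j, v'' j ≠ v j := by
      by_contra hc
      push Not at hc
      exact hv (funext hc)
    rw [Finset.prod_eq_zero (Finset.mem_univ j) (by exact Matrix.one_apply_ne' hj), mul_zero,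
      zero_smul]
  · intro h
    exact absurd (Finset.mem_univ v) h

/-- The action of `diag(1, h)` at a glued word: only the second parts move. [folklore] -/
theorem vecWordRep_one_blockDiagGL_apply_glueWord {X : Word (a + b) D → E}
    (hX : ∀ W, ¬ IsBlockWord P W → X W = 0) (h : GL (Fin b) k) (u : Word a m) (v' : Word b m') :
    vecWordRep k (a + b) D E (blockDiagGL 1 h) X (glueWord P eP eN u v') =
      ∑ v : Word b m', (∏ j, (h : Matrix (Fin b) (Fin b) k) (v' j) (v j)) • X (glueWord P eP eN u v) := by
  rw [vecWordRep_blockDiagGL_apply_glueWord P eP eN hX, Finset.sum_eq_single u]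
  · refine Finset.sum_congr rfl fun v _ => ?_
    congr 1
    simp
  · intro u'' _ hu
    obtain ⟨i, hi⟩ : ∃ i, u'' i ≠ u i := by
      by_contra hc
      push Not at hc
      exact hu (funext hc)
    refine Finset.sum_eq_zero fun v _ => ?_
    rw [Finset.prod_eq_zero (Finset.mem_univ i) (by exact Matrix.one_apply_ne' hi), zero_mul, zero_smul]
  · intro h'
    exact absurd (Finset.mem_univ u) h'

/-- **`curryA` intertwines `diag(g, 1)` with the `GL_a`-action on the outer word** (on block-supported
vectors). [cite: ChristandlVranaZuiddam2023, Lemma 3.10 (proof)] -/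
theorem curryA_vecWordRep_blockDiagGL_one {X : Word (a + b) D → E}
    (hX : ∀ W, ¬ IsBlockWord P W → X W = 0) (g : GL (Fin a) k) :
    curryA k P eP eN (vecWordRep k (a + b) D E (blockDiagGL g 1) X) =
      vecWordRep k a m (Word b m' → E) g (curryA k P eP eN X) := by
  funext u' v'
  rw [curryA_apply, vecWordRep_blockDiagGL_one_apply_glueWord P eP eN hX, vecWordRep_apply,
    Finset.sum_apply]
  refine Finset.sum_congr rfl fun u _ => ?_
  rw [Pi.smul_apply, curryA_apply]

/-- **`curryB` intertwines `diag(1, h)` with the `GL_b`-action on the outer word** (on block-supported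
vectors). [cite: ChristandlVranaZuiddam2023, Lemma 3.10 (proof)] -/
theorem curryB_vecWordRep_one_blockDiagGL {X : Word (a + b) D → E}
    (hX : ∀ W, ¬ IsBlockWord P W → X W = 0) (h : GL (Fin b) k) :
    curryB k P eP eN (vecWordRep k (a + b) D E (blockDiagGL 1 h) X) =
      vecWordRep k b m' (Word a m → E) h (curryB k P eP eN X) := by
  funext v' u'
  rw [curryB_apply, vecWordRep_one_blockDiagGL_apply_glueWord P eP eN hX, vecWordRep_apply,
    Finset.sum_apply]
  refine Finset.sum_congr rfl fun v _ => ?_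
  rw [Pi.smul_apply, curryB_apply]

/-! ## Block-supported vectors and the image of `Z_μ^{[P]} Z_ν^{[Pᶜ]}` -/

variable (k a b E)

/-- The subspace of vectors supported on block words (the coordinate form of
`V^{⊗m} ⊗ W^{⊗m'} ⊗ E ⊆ (V ⊕ W)^{⊗D} ⊗ E`). [cite: ChristandlVranaZuiddam2023, Lemma 3.11 (proof)] -/
def blockSubmodule : Submodule k (Word (a + b) D → E) where
  carrier := {X | ∀ W, ¬ IsBlockWord P W → X W = 0}
  add_mem' {X Y} hX hY W hW := by simp [hX W hW, hY W hW]
  zero_mem' W _ := rfl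
  smul_mem' c {X} hX W hW := by simp [hX W hW]

/-- **The image of `Z_μ^{[P]} Z_ν^{[Pᶜ]}` on the block-supported vectors** — the coordinate form of
the range of `P_μ^V ⊗ P_ν^W` inside `(V ⊕ W)^{⊗D} ⊗ E` (up to the nonzero scalars relating character
sums and isotypic projectors). [cite: ChristandlVranaZuiddam2023, §3.1 (before Lemma 3.11)] -/
def blockIsotypic (μ : Nat.Partition m) (ν : Nat.Partition m') : Submodule k (Word (a + b) D → E) :=
  (blockSubmodule k a b P E).map
    ((∑ σ, spechtCharacter k μ σ • repP k P eP E σ) ∘ₗ (∑ τ, spechtCharacter k ν τ • repN k P eN E τ))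

variable {k a b E}

omit [DecidablePred P] in
/-- Membership in `blockSubmodule`. [folklore] -/
theorem mem_blockSubmodule {X : Word (a + b) D → E} :
    X ∈ blockSubmodule k a b P E ↔ ∀ W, ¬ IsBlockWord P W → X W = 0 := Iff.rfl

/-- `blockSubmodule` is stable under `S_m` on the `P`-positions. [folklore] -/
theorem repP_mem_blockSubmodule (σ : Equiv.Perm (Fin m)) {X : Word (a + b) D → E}
    (hX : X ∈ blockSubmodule k a b P E) : repP k P eP E σ X ∈ blockSubmodule k a b P E := by
  intro W hW
  rw [repP_apply]
  exact hX _ fun h => hW ((isBlockWord_comp_iff P W (pos_embP_iff P eP σ)).1 h)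

/-- `blockSubmodule` is stable under `S_{m'}` off `P`. [folklore] -/
theorem repN_mem_blockSubmodule (τ : Equiv.Perm (Fin m')) {X : Word (a + b) D → E}
    (hX : X ∈ blockSubmodule k a b P E) : repN k P eN E τ X ∈ blockSubmodule k a b P E := by
  intro W hW
  rw [repN_apply]
  exact hX _ fun h => hW ((isBlockWord_comp_iff P W (pos_embN_iff P eN τ)).1 h)

/-- `blockSubmodule` is stable under `Z_μ^{[P]}`. [folklore] -/
theorem charSumP_mem_blockSubmodule (μ : Nat.Partition m) {X : Word (a + b) D → E}
    (hX : X ∈ blockSubmodule k a b P E) :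
    (∑ σ, spechtCharacter k μ σ • repP k P eP E σ) X ∈ blockSubmodule k a b P E := by
  rw [LinearMap.sum_apply]
  exact Submodule.sum_mem _ fun σ _ => Submodule.smul_mem _ _ (repP_mem_blockSubmodule P eP σ hX)

/-- `blockSubmodule` is stable under `Z_ν^{[Pᶜ]}`. [folklore] -/
theorem charSumN_mem_blockSubmodule (ν : Nat.Partition m') {X : Word (a + b) D → E}
    (hX : X ∈ blockSubmodule k a b P E) :
    (∑ τ, spechtCharacter k ν τ • repN k P eN E τ) X ∈ blockSubmodule k a b P E := by
  rw [LinearMap.sum_apply]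
  exact Submodule.sum_mem _ fun τ _ => Submodule.smul_mem _ _ (repN_mem_blockSubmodule P eN τ hX)

omit [DecidablePred P] in
/-- `blockSubmodule` is stable under the block-diagonal subgroup. [folklore] -/
theorem vecWordRep_blockDiagGL_mem_blockSubmodule (g : GL (Fin a) k) (h : GL (Fin b) k)
    {X : Word (a + b) D → E} (hX : X ∈ blockSubmodule k a b P E) :
    vecWordRep k (a + b) D E (blockDiagGL g h) X ∈ blockSubmodule k a b P E :=
  fun W hW => vecWordRep_blockDiagGL_apply_eq_zero P hX g h W hW

/-- `blockIsotypic μ ν` consists of block-supported vectors. [folklore] -/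
theorem blockIsotypic_le_blockSubmodule (μ : Nat.Partition m) (ν : Nat.Partition m') :
    blockIsotypic k a b P eP eN E μ ν ≤ blockSubmodule k a b P E := by
  rintro _ ⟨X, hX, rfl⟩
  exact charSumP_mem_blockSubmodule P eP μ (charSumN_mem_blockSubmodule P eN ν hX)

/-- `blockIsotypic` is stable under the block-diagonal subgroup. [folklore] -/
theorem vecWordRep_blockDiagGL_mem_blockIsotypic (μ : Nat.Partition m) (ν : Nat.Partition m')
    (g : GL (Fin a) k) (h : GL (Fin b) k) {X : Word (a + b) D → E}
    (hX : X ∈ blockIsotypic k a b P eP eN E μ ν) :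
    vecWordRep k (a + b) D E (blockDiagGL g h) X ∈ blockIsotypic k a b P eP eN E μ ν := by
  obtain ⟨Y, hY, rfl⟩ := hX
  refine ⟨vecWordRep k (a + b) D E (blockDiagGL g h) Y,
    vecWordRep_blockDiagGL_mem_blockSubmodule P g h hY, ?_⟩
  rw [LinearMap.comp_apply, LinearMap.comp_apply,
    charSum_apply_comm _ (repN k P eN E) (vecWordRep k (a + b) D E (blockDiagGL g h))
      (fun τ v => repN_vecWordRep P eN τ _ v),
    charSum_apply_comm _ (repP k P eP E) (vecWordRep k (a + b) D E (blockDiagGL g h))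
      (fun σ v => repP_vecWordRep P eP σ _ v)]

variable [IsAlgClosed k] [CharZero k] [FiniteDimensional k E]

/-- On `blockIsotypic μ ν`, `Z_μ^{[P]}` is the scalar `m!/f^μ`. [folklore] -/
theorem charSumP_apply_of_mem_blockIsotypic {μ : Nat.Partition m} {ν : Nat.Partition m'}
    {X : Word (a + b) D → E} (hX : X ∈ blockIsotypic k a b P eP eN E μ ν) :
    (∑ σ, spechtCharacter k μ σ • repP k P eP E σ) X =
      ((m.factorial : k) / (numStandardTableaux μ : k)) • X := by
  obtain ⟨Y, -, rfl⟩ := hX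
  exact charSum_apply_of_mem_range (repP k P eP E) μ (LinearMap.mem_range_self _ _)

/-- On `blockIsotypic μ ν`, `Z_ν^{[Pᶜ]}` is the scalar `m'!/f^ν`. [folklore] -/
theorem charSumN_apply_of_mem_blockIsotypic {μ : Nat.Partition m} {ν : Nat.Partition m'}
    {X : Word (a + b) D → E} (hX : X ∈ blockIsotypic k a b P eP eN E μ ν) :
    (∑ τ, spechtCharacter k ν τ • repN k P eN E τ) X =
      ((m'.factorial : k) / (numStandardTableaux ν : k)) • X := by
  obtain ⟨Y, -, rfl⟩ := hX
  rw [LinearMap.comp_apply, charSumP_charSumN_comm]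
  exact charSum_apply_of_mem_range (repN k P eN E) ν (LinearMap.mem_range_self _ _)

/-- **Littlewood–Richardson dominance `μ ∪ ν ⊴ λ`, support form.** If `X` lies in the image of
`Z_μ^{[P]} Z_ν^{[Pᶜ]}` on the block-supported vectors (the coordinate form of `im (P_μ^V ⊗ P_ν^W)`,
`V = k^a`, `W = k^b`) and `Z_λ X ≠ 0` for a partition `λ ⊢ D` (so that `P_λ^{V⊕W}(P_μ^V ⊗ P_ν^W) ≠ 0`,
i.e. `c^λ_{μν} ≠ 0` in the source), then `μ` has at most `a` parts, `ν` at most `b` parts, and the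
content `(μ₁, …, μ_a, ν₁, …, ν_b)` is dominated by `λ`: `∑_{x ∈ S} c_x ≤ λ₁ + ⋯ + λ_{|S|}` for all
`S` — equivalently, the partition `μ ∪ ν` is dominated by `λ` (the trivial half of the
Littlewood–Richardson rule, Fulton–Harris (A.8); it is what enters CVZ Lemma 3.10.2 / 3.11 via the
Schur concavity of the entropy, Remark 3.33). [cite: ChristandlVranaZuiddam2023, §3.1 (before Lemma 3.11)] -/
theorem sum_append_le_of_charSum_ne_zero {μ : Nat.Partition m} {ν : Nat.Partition m'}
    {X : Word (a + b) D → E} (hX : X ∈ blockIsotypic k a b P eP eN E μ ν) (lam : Nat.Partition D)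
    (hZ : (∑ π, spechtCharacter k lam π • vecWordPermRep k (a + b) D E π) X ≠ 0) :
    μ.parts.card ≤ a ∧ ν.parts.card ≤ b ∧
      ∀ S : Finset (Fin (a + b)),
        ∑ x ∈ S, Fin.append (fun i : Fin a => μ.sortedParts.getD i 0)
            (fun j : Fin b => ν.sortedParts.getD j 0) x ≤ (lam.sortedParts.take S.card).sum := by
  classical
  set ρ := vecWordRep k (a + b) D E with hρ
  set Zl : Module.End k (Word (a + b) D → E) :=
    ∑ π, spechtCharacter k lam π • vecWordPermRep k (a + b) D E π with hZl
  set F := blockIsotypic k a b P eP eN E μ ν with hFdef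
  have hFblock : ∀ {v}, v ∈ F → ∀ W, ¬ IsBlockWord P W → v W = 0 := fun hv =>
    blockIsotypic_le_blockSubmodule P eP eN μ ν hv
  have hZl_comm : ∀ (g' : GL (Fin (a + b)) k) (v : Word (a + b) D → E), Zl (ρ g' v) = ρ g' (Zl v) :=
    fun g' v => charSum_apply_comm _ (vecWordPermRep k (a + b) D E) (ρ g')
      (fun π w => vecWordPermRep_vecWordRep π g' w) v
  have hcμ : (m.factorial : k) / (numStandardTableaux μ : k) ≠ 0 :=
    factorial_div_numStandardTableaux_ne_zero μ
  have hcν : (m'.factorial : k) / (numStandardTableaux ν : k) ≠ 0 :=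
    factorial_div_numStandardTableaux_ne_zero ν
  -- ### Step A: climbing in `GL_a`
  set cA := curryA k P eP eN (E := E) with hcA
  set FA : Submodule k (Word a m → Word b m' → E) := F.map cA with hFA_def
  set KA : Submodule k (Word a m → Word b m' → E) := (F ⊓ LinearMap.ker Zl).map cA with hKA_def
  have hFA : ∀ g, FA ≤ FA.comap (vecWordRep k a m (Word b m' → E) g) := by
    rintro g _ ⟨v, hv, rfl⟩
    refine ⟨ρ (blockDiagGL g 1) v, vecWordRep_blockDiagGL_mem_blockIsotypic P eP eN μ ν g 1 hv, ?_⟩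
    exact curryA_vecWordRep_blockDiagGL_one P eP eN (hFblock hv) g
  have hKA : ∀ g, KA ≤ KA.comap (vecWordRep k a m (Word b m' → E) g) := by
    rintro g _ ⟨v, ⟨hvF, hvK⟩, rfl⟩
    refine ⟨ρ (blockDiagGL g 1) v,
      ⟨vecWordRep_blockDiagGL_mem_blockIsotypic P eP eN μ ν g 1 hvF, ?_⟩,
      curryA_vecWordRep_blockDiagGL_one P eP eN (hFblock hvF) g⟩
    change Zl v = 0 at hvK
    change Zl (ρ (blockDiagGL g 1) v) = 0
    rw [hZl_comm, hvK, map_zero]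
  have hKFA : ¬ FA ≤ KA := by
    intro hle
    obtain ⟨y, ⟨hyF, hyK⟩, hy⟩ := hle ⟨X, hX, rfl⟩
    have h0 : X - y = 0 := by
      refine eq_zero_of_curryA_eq_zero P eP eN (k := k) (fun W hW => ?_) ?_
      · rw [Pi.sub_apply, hFblock hX W hW, hFblock hyF W hW, sub_zero]
      · rw [map_sub, sub_eq_zero]
        exact hy.symm
    rw [sub_eq_zero] at h0
    rw [h0] at hZ
    exact hZ hyK
  have hisoA : ∀ w ∈ FA, (∑ σ, spechtCharacter k μ σ • vecWordPermRep k a m (Word b m' → E) σ) w =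
      ((m.factorial : k) / (numStandardTableaux μ : k)) • w := by
    rintro _ ⟨v, hv, rfl⟩
    rw [← curryA_charSumP, charSumP_apply_of_mem_blockIsotypic P eP eN hv, map_smul]
  obtain ⟨y₁', hy₁'F, hy₁'K, hμa, hsupp₁⟩ :=
    exists_not_mem_of_charSum_eq_smul hFA hKA hKFA μ hcμ hisoA
  obtain ⟨y₁, hy₁F, rfl⟩ := hy₁'F
  have hy₁Z : Zl y₁ ≠ 0 := fun h0 => hy₁'K ⟨y₁, ⟨hy₁F, h0⟩, rfl⟩
  -- ### Step B: climbing in `GL_b`, keeping the first parts of content `μ`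
  let S₁ : Submodule k (Word (a + b) D → E) :=
    { carrier := {y | ∀ u : Word a m, (∃ i, (wordContent u i : ℤ) ≠ Weight.ofPartition a μ i) →
        ∀ v : Word b m', y (glueWord P eP eN u v) = 0}
      add_mem' := fun {y y'} hy hy' u hu v => by simp [hy u hu v, hy' u hu v]
      zero_mem' := fun u _ v => rfl
      smul_mem' := fun c {y} hy u hu v => by simp [hy u hu v] }
  have hS₁mem : ∀ y : Word (a + b) D → E, y ∈ S₁ ↔ ∀ u : Word a m,
      (∃ i, (wordContent u i : ℤ) ≠ Weight.ofPartition a μ i) →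
        ∀ v : Word b m', y (glueWord P eP eN u v) = 0 := fun y => Iff.rfl
  set F₁ := F ⊓ S₁ with hF₁_def
  have hy₁F₁ : y₁ ∈ F₁ := by
    refine ⟨hy₁F, (hS₁mem y₁).2 fun u ⟨i, hi⟩ v => ?_⟩
    have := congrFun (hsupp₁ u i hi) v
    rwa [curryA_apply] at this
  have hF₁stab : ∀ (h : GL (Fin b) k), ∀ v ∈ F₁, ρ (blockDiagGL 1 h) v ∈ F₁ := by
    rintro h v ⟨hvF, hvS⟩
    refine ⟨vecWordRep_blockDiagGL_mem_blockIsotypic P eP eN μ ν 1 h hvF,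
      (hS₁mem _).2 fun u hu v' => ?_⟩
    rw [vecWordRep_one_blockDiagGL_apply_glueWord P eP eN (hFblock hvF)]
    exact Finset.sum_eq_zero fun v _ => by rw [(hS₁mem _).1 hvS u hu v, smul_zero]
  set cB := curryB k P eP eN (E := E) with hcB
  set FB : Submodule k (Word b m' → Word a m → E) := F₁.map cB with hFB_def
  set KB : Submodule k (Word b m' → Word a m → E) := (F₁ ⊓ LinearMap.ker Zl).map cB with hKB_def
  have hFB : ∀ h, FB ≤ FB.comap (vecWordRep k b m' (Word a m → E) h) := by
    rintro h _ ⟨v, hv, rfl⟩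
    refine ⟨ρ (blockDiagGL 1 h) v, hF₁stab h v hv, ?_⟩
    exact curryB_vecWordRep_one_blockDiagGL P eP eN (hFblock hv.1) h
  have hKB : ∀ h, KB ≤ KB.comap (vecWordRep k b m' (Word a m → E) h) := by
    rintro h _ ⟨v, ⟨hvF, hvK⟩, rfl⟩
    refine ⟨ρ (blockDiagGL 1 h) v, ⟨hF₁stab h v hvF, ?_⟩,
      curryB_vecWordRep_one_blockDiagGL P eP eN (hFblock hvF.1) h⟩
    change Zl v = 0 at hvK
    change Zl (ρ (blockDiagGL 1 h) v) = 0
    rw [hZl_comm, hvK, map_zero]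
  have hKFB : ¬ FB ≤ KB := by
    intro hle
    obtain ⟨y, ⟨hyF, hyK⟩, hy⟩ := hle ⟨y₁, hy₁F₁, rfl⟩
    have h0 : y₁ - y = 0 := by
      refine eq_zero_of_curryB_eq_zero P eP eN (k := k) (fun W hW => ?_) ?_
      · rw [Pi.sub_apply, hFblock hy₁F W hW, hFblock hyF.1 W hW, sub_zero]
      · rw [map_sub, sub_eq_zero]
        exact hy.symm
    rw [sub_eq_zero] at h0
    rw [h0] at hy₁Z
    exact hy₁Z hyK
  have hisoB : ∀ w ∈ FB, (∑ τ, spechtCharacter k ν τ • vecWordPermRep k b m' (Word a m → E) τ) w =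
      ((m'.factorial : k) / (numStandardTableaux ν : k)) • w := by
    rintro _ ⟨v, hv, rfl⟩
    rw [← curryB_charSumN, charSumN_apply_of_mem_blockIsotypic P eP eN hv.1, map_smul]
  obtain ⟨z', hz'F, hz'K, hνb, hsupp₂⟩ :=
    exists_not_mem_of_charSum_eq_smul hFB hKB hKFB ν hcν hisoB
  obtain ⟨z, hzF₁, rfl⟩ := hz'F
  have hzZ : Zl z ≠ 0 := fun h0 => hz'K ⟨z, ⟨hzF₁, h0⟩, rfl⟩
  -- ### Step C: the support of `Z_λ z`
  obtain ⟨W', hW'⟩ : ∃ W', Zl z W' ≠ 0 := Function.ne_iff.1 hzZ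
  obtain ⟨φ, hφ⟩ : ∃ φ : Module.Dual k E, φ (Zl z W') ≠ 0 := by
    by_contra hc
    push Not at hc
    exact hW' ((Module.forall_dual_apply_eq_zero_iff k (Zl z W')).1 hc)
  have hx : (∑ π, spechtCharacter k lam π • wordPermRep k (a + b) D π) (fun W => φ (z W)) W' ≠ 0 := by
    rwa [← dual_charSum_vecWordPermRep_apply]
  have hdom := fun S => card_filter_mem_le_of_mem_range_charSum lam (LinearMap.mem_range_self _ _) hx S
  obtain ⟨π, hπ⟩ : ∃ π : Equiv.Perm (Fin D), z (W' ∘ π) ≠ 0 := by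
    by_contra hall
    push Not at hall
    apply hW'
    rw [hZl, LinearMap.sum_apply, Finset.sum_apply]
    exact Finset.sum_eq_zero fun π _ => by
      rw [LinearMap.smul_apply, Pi.smul_apply, vecWordPermRep_apply, hall π, smul_zero]
  set W := W' ∘ π with hWdef
  have hWblock : IsBlockWord P W := by
    by_contra hnb
    exact hπ (hFblock hzF₁.1 W hnb)
  set u := fstPart P eP W hWblock with hudef
  set v := sndPart P eN W hWblock with hvdef
  have hWuv : glueWord P eP eN u v = W := glueWord_fstPart_sndPart P eP eN W hWblock
  have hu : ∀ i, (wordContent u i : ℤ) = Weight.ofPartition a μ i := by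
    by_contra hc
    push Not at hc
    exact hπ (by rw [← hWuv]; exact (hS₁mem z).1 hzF₁.2 u hc v)
  have hv : ∀ j, (wordContent v j : ℤ) = Weight.ofPartition b ν j := by
    by_contra hc
    push Not at hc
    obtain ⟨j, hj⟩ := hc
    have := congrFun (hsupp₂ v j hj) u
    rw [curryB_apply] at this
    exact hπ (by rw [← hWuv]; exact this)
  refine ⟨hμa, hνb, fun S => ?_⟩
  have hcontent : ∀ x, Fin.append (fun i : Fin a => μ.sortedParts.getD i 0)
      (fun j : Fin b => ν.sortedParts.getD j 0) x = wordContent W x := by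
    intro x
    induction x using Fin.addCases with
    | left i =>
      rw [Fin.append_left, ← hWuv, wordContent_glueWord_castAdd]
      have := hu i
      simp only [Weight.ofPartition, Nat.cast_inj] at this
      exact this.symm
    | right j =>
      rw [Fin.append_right, ← hWuv, wordContent_glueWord_natAdd]
      have := hv j
      simp only [Weight.ofPartition, Nat.cast_inj] at this
      exact this.symm
  calc ∑ x ∈ S, Fin.append (fun i : Fin a => μ.sortedParts.getD i 0)
          (fun j : Fin b => ν.sortedParts.getD j 0) x
        = ∑ x ∈ S, wordContent W x := Finset.sum_congr rfl fun x _ => hcontent x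
    _ = (Finset.univ.filter fun p : Fin D => W p ∈ S).card :=
        (card_filter_mem_eq_sum_wordContent W S).symm
    _ = (Finset.univ.filter fun p : Fin D => W' p ∈ S).card := card_filter_comp_perm_mem W' π S
    _ ≤ (lam.sortedParts.take S.card).sum := hdom S

end Block

end Literature.NumberTheory.DiophantineGeometry

end
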